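import Literature.MathematicalPhysics.KineticTheory.LangevinChainLyapunov
import Literature.MathematicalPhysics.KineticTheory.LangevinChainGibbs
import Mathlib.Analysis.SpecialFunctions.SmoothTransition
import Mathlib.Analysis.ODE.Gronwall
import Mathlib.Analysis.Calculus.ContDiff.Deriv
import Mathlib.MeasureTheory.Integral.IntervalIntegral.FundThmCalculus
import Mathlib.MeasureTheory.Integral.DominatedConvergence
import HarnessLib

/-!
# The a-priori bound `P^t e^{θH} ≤ e^{C_* t} e^{θH}` for every Markov semigroup of the Langevin chain

Trunk T-KINETIC (Literature/MathematicalPhysics/KineticTheory). Cuneo–Eckmann–Hairer–Rey-Bellet,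
*Non-equilibrium steady states for networks of oscillators*, Electron. J. Probab. 23 (2018),
no. 55, §3, p. 7 (arXiv pagination): "for all `0 < θ < 1/T_max` … (3.3)
`L e^{θH} = ∑_{b∈B} θγ_b ([θT_b - 1] p_b² + T_b) e^{θH} ≤ C_* e^{θH}` … and for all `t ≥ 0` we
have (3.4) `P^t V ≤ e^{C_* t} V`", `V = e^{θH}`, `C_* = θ ∑_b γ_b T_b`.

In the paper (3.4) is obtained from (3.3) by Itô's formula for the solution of the SDE (2.2)
and Fatou/Gronwall. Here we PROVE (3.4) for EVERY object of the interface
`LangevinChainSemigroup P N T_L T_R` of `LangevinSemigroup.lean` (Markov kernels + Chapman–Kolmogorov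
+ Dynkin's identity on `C_c^∞`), for any chain with smooth potentials whose Hamiltonian has compact
sublevel sets, `γ ≥ 0`, `T_L, T_R ≥ 0`, `0 ≤ θ` with `θ T_L, θ T_R ≤ 1`, `N ≥ 1`:

* `LangevinChainSemigroup.lintegral_exp_mul_hamiltonian_le` —
  `∫ e^{θH(y)} P_t(z, dy) ≤ e^{θγ(T_L+T_R)t} e^{θH(z)}` (as a Lebesgue integral, no integrability
  side condition), and its specialisation `pinnedChain_lintegral_exp_mul_hamiltonian_kernel_le` in
  the exact form of the conjunct (3.4) of the named fact `CuneoEckmannHairerReyBellet2018_lyapunov`.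

The proof replaces the localisation by stopping times with smooth truncations of the Lyapunov
function to which Dynkin's identity applies: `F_R(x) = 1 + ∫₀ˣ θ e^{θs} χ(s/R) ds` with a smooth
decreasing cutoff `χ` (`= 1` on `(-∞,1]`, `= 0` on `[2,∞)`, built from `Real.smoothTransition`)
satisfies `F_R = e^{θx}` on `(-∞, R]`, `F_R` constant on `[2R, ∞)`, `0 ≤ F_R' ≤ θ F_R`,
`F_R'' ≤ θ F_R'`, `F_R ≤ e^{θx}`; hence `u = F_R∘H - F_R(2R) ∈ C_c^∞` and (the computation (3.3)
for `F∘H`, `OscillatorChain.generator_comp_hamiltonian_le`) `L(F_R∘H) ≤ C_*·F_R∘H`. Dynkin's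
identity gives `φ(t) = φ(0) + ∫₀ᵗ ψ` for `φ(t) = P_t(F_R∘H)(z)`, `ψ = P_s(L(F_R∘H))(z) ≤ C_* φ(s)`,
Gronwall's inequality (`norm_le_gronwallBound_of_norm_deriv_right_le` applied to `∫₀ᵗ φ`) gives
`φ(t) ≤ e^{C_* t} F_R(H(z)) ≤ e^{C_* t} e^{θH(z)}`, and Fatou's lemma (`R → ∞`, `F_R∘H → e^{θH}`
pointwise, eventually constant) gives (3.4).

## References

* N. Cuneo, J.-P. Eckmann, M. Hairer, L. Rey-Bellet, EJP 23 (2018) no. 55, §3 eqs. (3.3)–(3.4).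
* R. Khasminskii, *Stochastic Stability of Differential Equations* (2nd ed., 2012), Thm 3.5
  (the Lyapunov-function bound `E V(X_t) ≤ e^{ct} V(x)` from `LV ≤ cV`).
-/

noncomputable section

open MeasureTheory ProbabilityTheory Filter Topology Set intervalIntegral
open scoped ContDiff NNReal ENNReal

namespace Literature.MathematicalPhysics.KineticTheory.HeatConduction

/-! ### A smooth decreasing cutoff and the truncated exponentials `F_R` -/

/-- A smooth decreasing cutoff `χ : ℝ → [0, 1]` with `χ = 1` on `(-∞, 1]` and `χ = 0` on
`[2, ∞)`: `χ(x) = Real.smoothTransition (2 - x)`. [folklore] -/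
def smoothCutoff (x : ℝ) : ℝ :=
  Real.smoothTransition (2 - x)

/-- `χ = 1` on `(-∞, 1]`. [folklore] -/
theorem smoothCutoff_of_le_one {x : ℝ} (h : x ≤ 1) : smoothCutoff x = 1 :=
  Real.smoothTransition.one_of_one_le (by linarith)

/-- `χ = 0` on `[2, ∞)`. [folklore] -/
theorem smoothCutoff_of_two_le {x : ℝ} (h : 2 ≤ x) : smoothCutoff x = 0 :=
  Real.smoothTransition.zero_of_nonpos (by linarith)

/-- `0 ≤ χ`. [folklore] -/
theorem smoothCutoff_nonneg (x : ℝ) : 0 ≤ smoothCutoff x :=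
  Real.smoothTransition.nonneg _

/-- `χ ≤ 1`. [folklore] -/
theorem smoothCutoff_le_one (x : ℝ) : smoothCutoff x ≤ 1 :=
  Real.smoothTransition.le_one _

/-- `χ` is decreasing. [folklore] -/
theorem antitone_smoothCutoff : Antitone smoothCutoff := fun _ _ h =>
  Real.smoothTransition.monotone (by linarith)

/-- `χ` is smooth. [folklore] -/
theorem contDiff_smoothCutoff {n : ℕ∞} : ContDiff ℝ n smoothCutoff :=
  Real.smoothTransition.contDiff.comp (contDiff_const.sub contDiff_id)

/-- `χ' ≤ 0`. [folklore] -/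
theorem deriv_smoothCutoff_nonpos (x : ℝ) : deriv smoothCutoff x ≤ 0 :=
  antitone_smoothCutoff.deriv_nonpos

/-- The derivative `F_R'(x) = θ e^{θx} χ(x/R)` of the truncated exponential. [folklore] -/
def expCutoffDeriv (θ R x : ℝ) : ℝ :=
  θ * Real.exp (θ * x) * smoothCutoff (x / R)

/-- The **truncated exponential** `F_R(x) = 1 + ∫₀ˣ θ e^{θs} χ(s/R) ds`: equal to `e^{θx}` on
`(-∞, R]`, constant on `[2R, ∞)`, with `0 ≤ F_R' ≤ θ F_R`, `F_R'' ≤ θ F_R'` and `F_R ≤ e^{θx}`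
(for `θ ≥ 0`, `R > 0`). [folklore] -/
def expCutoff (θ R x : ℝ) : ℝ :=
  1 + ∫ s in (0 : ℝ)..x, expCutoffDeriv θ R s

section Cutoff

variable (θ R : ℝ)

/-- `F_R'` is continuous. [folklore] -/
theorem continuous_expCutoffDeriv : Continuous (expCutoffDeriv θ R) := by
  have hc : Continuous smoothCutoff := (contDiff_smoothCutoff (n := 0)).continuous
  unfold expCutoffDeriv
  fun_prop

/-- `F_R'` is smooth. [folklore] -/
theorem contDiff_expCutoffDeriv : ContDiff ℝ ∞ (expCutoffDeriv θ R) := by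
  unfold expCutoffDeriv
  exact ((contDiff_const.mul (contDiff_const.mul contDiff_id).exp).mul
    (contDiff_smoothCutoff.comp (contDiff_id.div_const R)))

/-- `F_R` has derivative `F_R'` (fundamental theorem of calculus). [folklore] -/
theorem hasDerivAt_expCutoff (x : ℝ) :
    HasDerivAt (expCutoff θ R) (expCutoffDeriv θ R x) x := by
  unfold expCutoff
  exact ((continuous_expCutoffDeriv θ R).integral_hasStrictDerivAt 0 x).hasDerivAt.const_add 1

/-- `deriv F_R = F_R'`. [folklore] -/
theorem deriv_expCutoff : deriv (expCutoff θ R) = expCutoffDeriv θ R :=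
  funext fun x => (hasDerivAt_expCutoff θ R x).deriv

/-- `F_R` is smooth. [folklore] -/
theorem contDiff_expCutoff : ContDiff ℝ ∞ (expCutoff θ R) :=
  contDiff_infty_iff_deriv.2 ⟨fun x => (hasDerivAt_expCutoff θ R x).differentiableAt,
    by rw [deriv_expCutoff]; exact contDiff_expCutoffDeriv θ R⟩

/-- `F_R` is continuous. [folklore] -/
theorem continuous_expCutoff : Continuous (expCutoff θ R) :=
  (contDiff_expCutoff θ R).continuous

/-- The second derivative: `F_R''(x) = θ F_R'(x) + θ e^{θx} χ'(x/R) / R`. [folklore] -/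
theorem hasDerivAt_expCutoffDeriv (x : ℝ) :
    HasDerivAt (expCutoffDeriv θ R)
      (θ * expCutoffDeriv θ R x + θ * Real.exp (θ * x) * (deriv smoothCutoff (x / R) / R)) x := by
  unfold expCutoffDeriv
  have h1 : HasDerivAt (fun y => θ * Real.exp (θ * y)) (θ * (Real.exp (θ * x) * θ)) x := by
    have := ((hasDerivAt_id x).const_mul θ).exp.const_mul θ
    simpa using this
  have h2 : HasDerivAt (fun y => smoothCutoff (y / R)) (deriv smoothCutoff (x / R) / R) x := by
    have hd : HasDerivAt smoothCutoff (deriv smoothCutoff (x / R)) (x / R) :=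
      ((contDiff_smoothCutoff (n := 1)).differentiable (by simp) _).hasDerivAt
    have := hd.comp x ((hasDerivAt_id x).div_const R)
    simpa [Function.comp_def, div_eq_mul_inv, mul_comm] using this
  exact (h1.mul h2).congr_deriv (by ring)

variable {θ R}

/-- `F_R'' ≤ θ F_R'` for `θ ≥ 0`, `R > 0` (since `χ' ≤ 0`). [folklore] -/
theorem deriv_expCutoffDeriv_le (hθ : 0 ≤ θ) (hR : 0 < R) (x : ℝ) :
    deriv (expCutoffDeriv θ R) x ≤ θ * expCutoffDeriv θ R x := by
  rw [(hasDerivAt_expCutoffDeriv θ R x).deriv]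
  have h : θ * Real.exp (θ * x) * (deriv smoothCutoff (x / R) / R) ≤ 0 := by
    have h1 : 0 ≤ θ * Real.exp (θ * x) := by positivity
    have h2 : deriv smoothCutoff (x / R) / R ≤ 0 :=
      div_nonpos_of_nonpos_of_nonneg (deriv_smoothCutoff_nonpos _) hR.le
    exact mul_nonpos_of_nonneg_of_nonpos h1 h2
  linarith

/-- `F_R' ≥ 0` for `θ ≥ 0`. [folklore] -/
theorem expCutoffDeriv_nonneg (hθ : 0 ≤ θ) (x : ℝ) : 0 ≤ expCutoffDeriv θ R x := by
  unfold expCutoffDeriv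
  have := smoothCutoff_nonneg (x / R)
  positivity

/-- `F_R' ≤ θ e^{θx}` for `θ ≥ 0`. [folklore] -/
theorem expCutoffDeriv_le_mul_exp (hθ : 0 ≤ θ) (x : ℝ) :
    expCutoffDeriv θ R x ≤ θ * Real.exp (θ * x) := by
  unfold expCutoffDeriv
  have h1 : 0 ≤ θ * Real.exp (θ * x) := by positivity
  simpa using mul_le_mul_of_nonneg_left (smoothCutoff_le_one (x / R)) h1

/-- `F_R'(x) = θ e^{θx}` for `x ≤ R` (`R > 0`). [folklore] -/
theorem expCutoffDeriv_of_le (hR : 0 < R) {x : ℝ} (hx : x ≤ R) :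
    expCutoffDeriv θ R x = θ * Real.exp (θ * x) := by
  unfold expCutoffDeriv
  rw [smoothCutoff_of_le_one ((div_le_one hR).2 hx), mul_one]

/-- `F_R'(x) = 0` for `x ≥ 2R` (`R > 0`). [folklore] -/
theorem expCutoffDeriv_of_ge (hR : 0 < R) {x : ℝ} (hx : 2 * R ≤ x) :
    expCutoffDeriv θ R x = 0 := by
  unfold expCutoffDeriv
  rw [smoothCutoff_of_two_le ((le_div_iff₀ hR).2 hx), mul_zero]

/-- `∫₀ˣ θ e^{θs} ds = e^{θx} - 1`. [folklore] -/
theorem integral_mul_exp_mul (θ x : ℝ) :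
    ∫ s in (0 : ℝ)..x, θ * Real.exp (θ * s) = Real.exp (θ * x) - 1 := by
  have h : ∀ s ∈ uIcc 0 x, HasDerivAt (fun y => Real.exp (θ * y)) (θ * Real.exp (θ * s)) s := by
    intro s _
    have := ((hasDerivAt_id s).const_mul θ).exp
    simpa [mul_comm] using this
  rw [integral_eq_sub_of_hasDerivAt h ((by fun_prop : Continuous fun s => θ * Real.exp (θ * s))
    |>.intervalIntegrable _ _)]
  simp

/-- `F_R = e^{θx}` on `(-∞, R]` (`R > 0`). [folklore] -/
theorem expCutoff_of_le (hR : 0 < R) {x : ℝ} (hx : x ≤ R) : expCutoff θ R x = Real.exp (θ * x) := by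
  unfold expCutoff
  have h : ∫ s in (0 : ℝ)..x, expCutoffDeriv θ R s = ∫ s in (0 : ℝ)..x, θ * Real.exp (θ * s) := by
    refine integral_congr fun s hs => ?_
    have hs' : s ≤ R := by
      rcases le_total 0 x with h0 | h0
      · rw [uIcc_of_le h0] at hs; exact hs.2.trans hx
      · rw [uIcc_of_ge h0] at hs; exact hs.2.trans hR.le
    exact expCutoffDeriv_of_le hR hs'
  rw [h, integral_mul_exp_mul]
  ring

/-- `F_R(0) = 1`. [folklore] -/
@[simp] theorem expCutoff_zero : expCutoff θ R 0 = 1 := by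
  simp [expCutoff]

/-- `F_R` is constant on `[2R, ∞)` (`R > 0`). [folklore] -/
theorem expCutoff_of_ge (hR : 0 < R) {x : ℝ} (hx : 2 * R ≤ x) :
    expCutoff θ R x = expCutoff θ R (2 * R) := by
  unfold expCutoff
  have hi : ∀ a b, IntervalIntegrable (expCutoffDeriv θ R) volume a b := fun a b =>
    (continuous_expCutoffDeriv θ R).intervalIntegrable a b
  rw [← integral_add_adjacent_intervals (hi 0 (2 * R)) (hi (2 * R) x)]
  have h0 : ∫ s in (2 * R)..x, expCutoffDeriv θ R s = 0 := by
    rw [integral_congr (g := fun _ => (0 : ℝ)) fun s hs => ?_]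
    · simp
    · rw [uIcc_of_le hx] at hs
      exact expCutoffDeriv_of_ge hR hs.1
  rw [h0, add_zero]

/-- `F_R` is nondecreasing for `θ ≥ 0`. [folklore] -/
theorem monotone_expCutoff (hθ : 0 ≤ θ) : Monotone (expCutoff θ R) :=
  monotone_of_deriv_nonneg (fun x => (hasDerivAt_expCutoff θ R x).differentiableAt) fun x => by
    rw [deriv_expCutoff]; exact expCutoffDeriv_nonneg hθ x

/-- `F_R > 0` (`θ ≥ 0`, `R > 0`). [folklore] -/
theorem expCutoff_pos (hθ : 0 ≤ θ) (hR : 0 < R) (x : ℝ) : 0 < expCutoff θ R x := by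
  rcases le_total x 0 with hx | hx
  · rw [expCutoff_of_le hR (hx.trans hR.le)]; exact Real.exp_pos _
  · calc (0 : ℝ) < 1 := one_pos
      _ = expCutoff θ R 0 := expCutoff_zero.symm
      _ ≤ expCutoff θ R x := monotone_expCutoff hθ hx

/-- **`F_R ≤ e^{θx}`** (`θ ≥ 0`, `R > 0`). [folklore] -/
theorem expCutoff_le_exp (hθ : 0 ≤ θ) (hR : 0 < R) (x : ℝ) :
    expCutoff θ R x ≤ Real.exp (θ * x) := by
  rcases le_total x 0 with hx | hx
  · rw [expCutoff_of_le hR (hx.trans hR.le)]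
  · -- `k = e^{θx} - F_R` is nondecreasing and `k(0) = 0`
    have hk : Monotone fun y => Real.exp (θ * y) - expCutoff θ R y := by
      refine monotone_of_deriv_nonneg (fun y => ?_) fun y => ?_
      · exact (((differentiableAt_id).const_mul θ).exp).sub
          (hasDerivAt_expCutoff θ R y).differentiableAt
      · have h1 : HasDerivAt (fun y => Real.exp (θ * y)) (θ * Real.exp (θ * y)) y := by
          have := ((hasDerivAt_id y).const_mul θ).exp
          simpa [mul_comm] using this
        have h3 : HasDerivAt (fun y => Real.exp (θ * y) - expCutoff θ R y)
            (θ * Real.exp (θ * y) - expCutoffDeriv θ R y) y := h1.sub (hasDerivAt_expCutoff θ R y)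
        rw [h3.deriv]
        linarith [expCutoffDeriv_le_mul_exp (R := R) hθ y]
    have := hk hx
    simp only [mul_zero, Real.exp_zero, expCutoff_zero, sub_self] at this
    linarith

/-- **`F_R' ≤ θ F_R`** (`θ ≥ 0`, `R > 0`): `e^{θx} χ(x/R) ≤ F_R(x)`, because the difference
`F_R - e^{θ·}χ(·/R)` vanishes on `(-∞, 0]` and has derivative `-e^{θx}χ'(x/R)/R ≥ 0`. [folklore] -/
theorem expCutoffDeriv_le (hθ : 0 ≤ θ) (hR : 0 < R) (x : ℝ) :
    expCutoffDeriv θ R x ≤ θ * expCutoff θ R x := by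
  have key : Real.exp (θ * x) * smoothCutoff (x / R) ≤ expCutoff θ R x := by
    rcases le_total x 0 with hx | hx
    · rw [expCutoff_of_le hR (hx.trans hR.le), smoothCutoff_of_le_one, mul_one]
      exact (div_nonpos_of_nonpos_of_nonneg hx hR.le).trans zero_le_one
    · have hg : Monotone fun y => expCutoff θ R y - Real.exp (θ * y) * smoothCutoff (y / R) := by
        have hd : ∀ y, HasDerivAt (fun y => Real.exp (θ * y) * smoothCutoff (y / R))
            (θ * Real.exp (θ * y) * smoothCutoff (y / R) +
              Real.exp (θ * y) * (deriv smoothCutoff (y / R) / R)) y := by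
          intro y
          have h1 : HasDerivAt (fun y => Real.exp (θ * y)) (θ * Real.exp (θ * y)) y := by
            have := ((hasDerivAt_id y).const_mul θ).exp
            simpa [mul_comm] using this
          have h2 : HasDerivAt (fun y => smoothCutoff (y / R)) (deriv smoothCutoff (y / R) / R) y := by
            have hd : HasDerivAt smoothCutoff (deriv smoothCutoff (y / R)) (y / R) :=
              ((contDiff_smoothCutoff (n := 1)).differentiable (by simp) _).hasDerivAt
            have := hd.comp y ((hasDerivAt_id y).div_const R)
            simpa [Function.comp_def, div_eq_mul_inv, mul_comm] using this
          exact h1.mul h2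
        refine monotone_of_deriv_nonneg (fun y => ?_) fun y => ?_
        · exact (hasDerivAt_expCutoff θ R y).differentiableAt.sub (hd y).differentiableAt
        · have h3 : HasDerivAt (fun y => expCutoff θ R y - Real.exp (θ * y) * smoothCutoff (y / R))
              (expCutoffDeriv θ R y - (θ * Real.exp (θ * y) * smoothCutoff (y / R) +
                Real.exp (θ * y) * (deriv smoothCutoff (y / R) / R))) y :=
            (hasDerivAt_expCutoff θ R y).sub (hd y)
          rw [h3.deriv]
          unfold expCutoffDeriv
          have h1 : 0 ≤ Real.exp (θ * y) := (Real.exp_pos _).le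
          have h2 : deriv smoothCutoff (y / R) / R ≤ 0 :=
            div_nonpos_of_nonpos_of_nonneg (deriv_smoothCutoff_nonpos _) hR.le
          nlinarith [mul_nonpos_of_nonneg_of_nonpos h1 h2]
      have := hg hx
      simp only [expCutoff_zero, mul_zero, Real.exp_zero, zero_div, one_mul,
        smoothCutoff_of_le_one (zero_le_one (α := ℝ)), sub_self] at this
      linarith
  unfold expCutoffDeriv
  calc θ * Real.exp (θ * x) * smoothCutoff (x / R)
      = θ * (Real.exp (θ * x) * smoothCutoff (x / R)) := by ring
    _ ≤ θ * expCutoff θ R x := mul_le_mul_of_nonneg_left key hθ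

/-- `F_R ≤ e^{2θR}` everywhere (`θ ≥ 0`, `R > 0`): a uniform bound. [folklore] -/
theorem expCutoff_le_exp_two_mul (hθ : 0 ≤ θ) (hR : 0 < R) (x : ℝ) :
    expCutoff θ R x ≤ Real.exp (θ * (2 * R)) := by
  rcases le_total x (2 * R) with hx | hx
  · exact (expCutoff_le_exp hθ hR x).trans (Real.exp_le_exp.2 (mul_le_mul_of_nonneg_left hx hθ))
  · rw [expCutoff_of_ge hR hx]; exact expCutoff_le_exp hθ hR _

/-- `F_{n+1}(x) → e^{θx}` as `n → ∞` (the sequence is eventually constant). [folklore] -/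
theorem tendsto_expCutoff_atTop (θ x : ℝ) :
    Tendsto (fun n : ℕ => expCutoff θ (n + 1) x) atTop (𝓝 (Real.exp (θ * x))) := by
  refine tendsto_const_nhds.congr' ?_
  obtain ⟨n₀, hn₀⟩ := exists_nat_ge x
  filter_upwards [eventually_ge_atTop n₀] with n hn
  rw [expCutoff_of_le (by positivity)]
  calc x ≤ n₀ := hn₀
    _ ≤ n := by exact_mod_cast hn
    _ ≤ n + 1 := by linarith

end Cutoff

/-! ### The generator applied to `F∘H` -/

namespace OscillatorChain

variable (P : OscillatorChain) {N : ℕ}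

/-- Chain rule along `(0, e_i)`: `∂_{p_i} F(H) = F'(H) p_i`. [folklore] -/
theorem hasLineDerivAt_comp_hamiltonian_unitP {F F' : ℝ → ℝ} (hF : ∀ u, HasDerivAt F (F' u) u)
    (N : ℕ) (x : PhaseSpace N) (i : Fin N) :
    HasLineDerivAt ℝ (fun y => F (P.hamiltonian N y)) (F' (P.hamiltonian N x) * x.2 i) x
      ((0, Pi.single i 1) : PhaseSpace N) := by
  have h := P.hasLineDerivAt_hamiltonian_unitP N x i
  unfold HasLineDerivAt at h ⊢
  have := (hF _).comp 0 h
  simpa [Function.comp_def] using this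

/-- Chain rule along `(e_i, 0)`: `∂_{q_i} F(H) = F'(H) ∂_{q_i}H`. [folklore] -/
theorem hasLineDerivAt_comp_hamiltonian_unitQ (hH : Differentiable ℝ (P.hamiltonian N))
    {F F' : ℝ → ℝ} (hF : ∀ u, HasDerivAt F (F' u) u) (x : PhaseSpace N) (i : Fin N) :
    HasLineDerivAt ℝ (fun y => F (P.hamiltonian N y))
      (F' (P.hamiltonian N x) * partialQ i (P.hamiltonian N) x) x
      ((Pi.single i 1, 0) : PhaseSpace N) := by
  have h := P.hasLineDerivAt_hamiltonian_unitQ hH x i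
  unfold HasLineDerivAt at h ⊢
  have := (hF _).comp 0 h
  simpa [Function.comp_def] using this

/-- `∂_{p_i} F(H) = F'(H) p_i` as functions. [folklore] -/
theorem partialP_comp_hamiltonian {F F' : ℝ → ℝ} (hF : ∀ u, HasDerivAt F (F' u) u) (N : ℕ)
    (i : Fin N) :
    partialP i (fun y => F (P.hamiltonian N y)) = fun x => F' (P.hamiltonian N x) * x.2 i := by
  funext x
  rw [partialP_eq_lineDeriv, (P.hasLineDerivAt_comp_hamiltonian_unitP hF N x i).lineDeriv]

/-- `∂_{q_i} F(H) = F'(H) ∂_{q_i} H`. [folklore] -/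
theorem partialQ_comp_hamiltonian (hH : Differentiable ℝ (P.hamiltonian N)) {F F' : ℝ → ℝ}
    (hF : ∀ u, HasDerivAt F (F' u) u) (x : PhaseSpace N) (i : Fin N) :
    partialQ i (fun y => F (P.hamiltonian N y)) x =
      F' (P.hamiltonian N x) * partialQ i (P.hamiltonian N) x := by
  rw [partialQ_eq_lineDeriv, (P.hasLineDerivAt_comp_hamiltonian_unitQ hH hF x i).lineDeriv]

/-- `∂_{p_i} (F'(H) p_i) = F''(H) p_i² + F'(H)`. [folklore] -/
theorem partialP_deriv_comp_hamiltonian_mul {F' F'' : ℝ → ℝ} (hF' : ∀ u, HasDerivAt F' (F'' u) u)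
    (N : ℕ) (x : PhaseSpace N) (i : Fin N) :
    partialP i (fun y => F' (P.hamiltonian N y) * y.2 i) x =
      F'' (P.hamiltonian N x) * x.2 i ^ 2 + F' (P.hamiltonian N x) := by
  rw [partialP_eq_lineDeriv]
  have h1 : HasLineDerivAt ℝ (fun y : PhaseSpace N => y.2 i) 1 x
      ((0, Pi.single i 1) : PhaseSpace N) := by
    unfold HasLineDerivAt
    simp only [add_smul_unitP_snd, Pi.add_apply, Pi.smul_apply, Pi.single_eq_same, smul_eq_mul,
      mul_one]
    simpa using (hasDerivAt_id (0 : ℝ)).const_add (x.2 i)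
  have h2 := P.hasLineDerivAt_comp_hamiltonian_unitP hF' N x i
  have h12 : HasLineDerivAt ℝ (fun y : PhaseSpace N => F' (P.hamiltonian N y) * y.2 i)
      (F'' (P.hamiltonian N x) * x.2 i * x.2 i + F' (P.hamiltonian N x) * 1) x
      ((0, Pi.single i 1) : PhaseSpace N) := by
    unfold HasLineDerivAt at h1 h2 ⊢
    have := h2.mul h1
    simpa [Pi.mul_def] using this
  rw [h12.lineDeriv]
  ring

/-- `∂²_{p_i} F(H) = F''(H) p_i² + F'(H)`. [folklore] -/
theorem partialP_partialP_comp_hamiltonian {F F' F'' : ℝ → ℝ} (hF : ∀ u, HasDerivAt F (F' u) u)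
    (hF' : ∀ u, HasDerivAt F' (F'' u) u) (N : ℕ) (x : PhaseSpace N) (i : Fin N) :
    partialP i (partialP i (fun y => F (P.hamiltonian N y))) x =
      F'' (P.hamiltonian N x) * x.2 i ^ 2 + F' (P.hamiltonian N x) := by
  rw [P.partialP_comp_hamiltonian hF N i, P.partialP_deriv_comp_hamiltonian_mul hF' N x i]

/-- **The generator applied to a function of the energy** (the computation (3.3) of CEHR 2018
for a general `F∘H`): the Hamiltonian part drops out (`{H, F(H)} = 0`) and each bath contributes
`γ (T_b ∂²_{p_b} - p_b ∂_{p_b}) F(H) = γ (T_b (F''(H) p_b² + F'(H)) - F'(H) p_b²)`.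
[cite: CuneoEckmannHairerReyBellet2018, §3 eq. (3.3)] -/
theorem generator_comp_hamiltonian (hH : Differentiable ℝ (P.hamiltonian N)) {F F' F'' : ℝ → ℝ}
    (hF : ∀ u, HasDerivAt F (F' u) u) (hF' : ∀ u, HasDerivAt F' (F'' u) u) (T_L T_R : ℝ)
    (x : PhaseSpace N) :
    P.generator N T_L T_R (fun y => F (P.hamiltonian N y)) x =
      P.γ * ∑ i : Fin N,
        ((if i.val = 0 then T_L * (F'' (P.hamiltonian N x) * x.2 i ^ 2 + F' (P.hamiltonian N x)) -
            F' (P.hamiltonian N x) * x.2 i ^ 2 else 0) +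
          (if i.val = N - 1 then
            T_R * (F'' (P.hamiltonian N x) * x.2 i ^ 2 + F' (P.hamiltonian N x)) -
              F' (P.hamiltonian N x) * x.2 i ^ 2 else 0)) := by
  simp only [generator, P.partialQ_comp_hamiltonian hH hF, P.partialP_comp_hamiltonian hF,
    P.partialP_deriv_comp_hamiltonian_mul hF']
  have h0 : ∀ i : Fin N, x.2 i * (F' (P.hamiltonian N x) * partialQ i (P.hamiltonian N) x) -
      partialQ i (P.hamiltonian N) x * (F' (P.hamiltonian N x) * x.2 i) = 0 := fun i => by ring
  simp only [h0, Finset.sum_const_zero, zero_add]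
  congr 1
  refine Finset.sum_congr rfl fun i _ => ?_
  split_ifs <;> ring

/-- **`L(F∘H) ≤ θγ(T_L + T_R) F(H)`** for `N ≥ 1`, `γ, T_L, T_R ≥ 0`, `θT_L, θT_R ≤ 1`,
whenever `0 ≤ F'(H) ≤ θ F(H)` and `F''(H) ≤ θ F'(H)` at the point: each bath term is
`T_b F'' p_b² + T_b F' - F' p_b² ≤ F' (T_b + (θT_b - 1) p_b²) ≤ F' T_b`. For `F = e^{θ·}` this is
CEHR (3.3) `L e^{θH} ≤ C_* e^{θH}`. [cite: CuneoEckmannHairerReyBellet2018, §3 eq. (3.3)] -/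
theorem generator_comp_hamiltonian_le (hH : Differentiable ℝ (P.hamiltonian N)) {F F' F'' : ℝ → ℝ}
    (hF : ∀ u, HasDerivAt F (F' u) u) (hF' : ∀ u, HasDerivAt F' (F'' u) u) (hN : 0 < N)
    (hγ : 0 ≤ P.γ) {T_L T_R θ : ℝ} (hTL : 0 ≤ T_L) (hTR : 0 ≤ T_R) (hL : θ * T_L ≤ 1)
    (hR : θ * T_R ≤ 1) (x : PhaseSpace N) (h1 : 0 ≤ F' (P.hamiltonian N x))
    (h2 : F' (P.hamiltonian N x) ≤ θ * F (P.hamiltonian N x))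
    (h3 : F'' (P.hamiltonian N x) ≤ θ * F' (P.hamiltonian N x)) :
    P.generator N T_L T_R (fun y => F (P.hamiltonian N y)) x ≤
      θ * P.γ * (T_L + T_R) * F (P.hamiltonian N x) := by
  rw [P.generator_comp_hamiltonian hH hF hF']
  set a := F (P.hamiltonian N x)
  set b := F' (P.hamiltonian N x)
  set c := F'' (P.hamiltonian N x)
  have hterm : ∀ (T : ℝ), 0 ≤ T → θ * T ≤ 1 → ∀ p : ℝ,
      T * (c * p ^ 2 + b) - b * p ^ 2 ≤ b * T := by
    intro T hT hθT p
    have hp : 0 ≤ p ^ 2 := sq_nonneg p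
    have e1 : T * (c * p ^ 2) ≤ T * (θ * b * p ^ 2) := by
      refine mul_le_mul_of_nonneg_left ?_ hT
      nlinarith
    nlinarith [mul_nonneg h1 hp, mul_nonneg (sub_nonneg.2 hθT) (mul_nonneg h1 hp)]
  have hsum : ∑ i : Fin N, ((if i.val = 0 then T_L * (c * x.2 i ^ 2 + b) - b * x.2 i ^ 2 else 0) +
      (if i.val = N - 1 then T_R * (c * x.2 i ^ 2 + b) - b * x.2 i ^ 2 else 0)) ≤ b * (T_L + T_R) := by
    have hle : ∀ i : Fin N, ((if i.val = 0 then T_L * (c * x.2 i ^ 2 + b) - b * x.2 i ^ 2 else 0) +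
        (if i.val = N - 1 then T_R * (c * x.2 i ^ 2 + b) - b * x.2 i ^ 2 else 0)) ≤
        (if i.val = 0 then b * T_L else 0) + (if i.val = N - 1 then b * T_R else 0) := by
      intro i
      refine add_le_add ?_ ?_
      · split_ifs
        · exact hterm T_L hTL hL _
        · exact le_rfl
      · split_ifs
        · exact hterm T_R hTR hR _
        · exact le_rfl
    refine (Finset.sum_le_sum fun i _ => hle i).trans (le_of_eq ?_)
    rw [Finset.sum_add_distrib]
    have e1 : ∑ i : Fin N, (if i.val = 0 then b * T_L else 0) = b * T_L := by
      rw [Finset.sum_eq_single_of_mem (⟨0, hN⟩ : Fin N) (Finset.mem_univ _)]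
      · simp
      · intro j _ hj
        rw [if_neg]
        exact fun h => hj (Fin.ext h)
    have e2 : ∑ i : Fin N, (if i.val = N - 1 then b * T_R else 0) = b * T_R := by
      rw [Finset.sum_eq_single_of_mem (⟨N - 1, by omega⟩ : Fin N) (Finset.mem_univ _)]
      · simp
      · intro j _ hj
        rw [if_neg]
        exact fun h => hj (Fin.ext h)
    rw [e1, e2]
    ring
  have hT : 0 ≤ T_L + T_R := add_nonneg hTL hTR
  calc P.γ * _ ≤ P.γ * (b * (T_L + T_R)) := mul_le_mul_of_nonneg_left hsum hγ
    _ ≤ P.γ * (θ * a * (T_L + T_R)) := by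
        refine mul_le_mul_of_nonneg_left (mul_le_mul_of_nonneg_right h2 hT) hγ
    _ = θ * P.γ * (T_L + T_R) * a := by ring

/-- The generator annihilates constants: `L(f - c) = L f`. [folklore] -/
theorem generator_sub_const (N : ℕ) (T_L T_R : ℝ) (f : PhaseSpace N → ℝ) (c : ℝ) :
    P.generator N T_L T_R (fun y => f y - c) = P.generator N T_L T_R f := by
  have hQ : ∀ i : Fin N, partialQ i (fun y => f y - c) = partialQ i f := fun i => by
    funext x; unfold partialQ; exact deriv_sub_const _
  have hP : ∀ (i : Fin N) (g : PhaseSpace N → ℝ), partialP i (fun y => g y - c) = partialP i g :=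
    fun i g => by funext x; unfold partialP; exact deriv_sub_const _
  funext x
  simp only [generator, hQ, hP]

end OscillatorChain

/-! ### (3.4) for every Markov semigroup of the chain -/

/-- A bounded strongly measurable real function is integrable on every bounded interval.
[folklore] -/
theorem intervalIntegrable_of_norm_le {f : ℝ → ℝ} (hf : StronglyMeasurable f) {C : ℝ}
    (hC : ∀ s, ‖f s‖ ≤ C) (a b : ℝ) : IntervalIntegrable f volume a b := by
  rw [intervalIntegrable_iff]
  refine Measure.integrableOn_of_bounded ?_ hf.aestronglyMeasurable (Eventually.of_forall hC)
  exact ((measure_mono uIoc_subset_uIcc).trans_lt isCompact_uIcc.measure_lt_top).ne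

namespace LangevinChainSemigroup

variable {P : OscillatorChain} {N : ℕ} {T_L T_R : ℝ} (S : LangevinChainSemigroup P N T_L T_R)

/-- A bounded continuous function is integrable against every transition probability. [folklore] -/
theorem integrable_kernel_of_norm_le (t : ℝ≥0) (z : PhaseSpace N) {g : PhaseSpace N → ℝ}
    (hg : Continuous g) {C : ℝ} (hC : ∀ y, ‖g y‖ ≤ C) : Integrable g (S.kernel t z) :=
  (integrable_const C).mono' hg.aestronglyMeasurable (Eventually.of_forall hC)

/-- **The truncated bound.** For a chain with smooth potentials, compact energy sublevel sets,
`γ, T_L, T_R ≥ 0`, `N ≥ 1`, `0 ≤ θ`, `θT_L, θT_R ≤ 1`, every Markov semigroup `S` of the chain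
(interface `LangevinChainSemigroup`) satisfies `P_t (F_R∘H)(z) ≤ e^{θγ(T_L+T_R)t} F_R(H(z))` for
the truncated exponentials `F_R`: Dynkin's identity for `F_R∘H - F_R(2R) ∈ C_c^∞`,
`L(F_R∘H) ≤ C_* F_R∘H`, and Gronwall's inequality.
[cite: CuneoEckmannHairerReyBellet2018, §3 eq. (3.4)] -/
theorem integral_expCutoff_hamiltonian_le (hU : ContDiff ℝ ∞ P.U) (hV : ContDiff ℝ ∞ P.V)
    (hN : 0 < N) (hγ : 0 ≤ P.γ) (hTL : 0 ≤ T_L) (hTR : 0 ≤ T_R)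
    (hprop : ∀ E : ℝ, IsCompact {x : PhaseSpace N | P.hamiltonian N x ≤ E})
    {θ : ℝ} (hθ : 0 ≤ θ) (hL : θ * T_L ≤ 1) (hR : θ * T_R ≤ 1) {R : ℝ} (hR0 : 0 < R)
    (t : ℝ≥0) (z : PhaseSpace N) :
    ∫ y, expCutoff θ R (P.hamiltonian N y) ∂(S.kernel t z) ≤
      Real.exp (θ * P.γ * (T_L + T_R) * t) * expCutoff θ R (P.hamiltonian N z) := by
  -- the truncated Lyapunov function `g = F_R∘H`, its compactly supported shift `u = g - F_R(2R)`
  set H := P.hamiltonian N with hHdef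
  set g : PhaseSpace N → ℝ := fun y => expCutoff θ R (H y) with hgdef
  set c : ℝ := expCutoff θ R (2 * R) with hcdef
  set u : PhaseSpace N → ℝ := fun y => g y - c with hudef
  set K : ℝ := θ * P.γ * (T_L + T_R) with hKdef
  have hU1 : ContDiff ℝ 1 P.U := hU.of_le (by norm_cast)
  have hV1 : ContDiff ℝ 1 P.V := hV.of_le (by norm_cast)
  have hHs : ContDiff ℝ ∞ H := P.contDiff_hamiltonian hU hV N
  have hHd : Differentiable ℝ H := hHs.differentiable (by simp)
  have hHc : Continuous H := hHs.continuous
  have hg_smooth : ContDiff ℝ ∞ g := (contDiff_expCutoff θ R).comp hHs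
  have hu_smooth : ContDiff ℝ ∞ u := hg_smooth.sub contDiff_const
  have hu_supp : HasCompactSupport u := by
    refine HasCompactSupport.intro (hprop (2 * R)) fun x hx => ?_
    simp only [mem_setOf_eq, not_le] at hx
    show expCutoff θ R (H x) - c = 0
    rw [expCutoff_of_ge hR0 hx.le, sub_self]
  have hg_nonneg : ∀ y, 0 ≤ g y := fun y => (expCutoff_pos hθ hR0 _).le
  have hg_norm : ∀ y, ‖g y‖ ≤ Real.exp (θ * (2 * R)) := fun y => by
    rw [Real.norm_of_nonneg (hg_nonneg y)]; exact expCutoff_le_exp_two_mul hθ hR0 _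
  have hg_cont : Continuous g := hg_smooth.continuous
  -- `L g = L u` is bounded and continuous, and `L g ≤ K g`
  have hLu : P.generator N T_L T_R u = P.generator N T_L T_R g := P.generator_sub_const N T_L T_R g c
  have hLg_cont : Continuous (P.generator N T_L T_R g) := by
    rw [← hLu]; exact P.continuous_generator hU1 hV1 N T_L T_R (hu_smooth.of_le (by norm_cast))
  obtain ⟨C, hC⟩ : ∃ C, ∀ x, ‖P.generator N T_L T_R g x‖ ≤ C := by
    obtain ⟨C, hC⟩ := P.exists_bound_generator hU1 hV1 N T_L T_R (hu_smooth.of_le (by norm_cast))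
      hu_supp
    exact ⟨C, fun x => by rw [← hLu]; exact hC x⟩
  have hLg_le : ∀ x, P.generator N T_L T_R g x ≤ K * g x := fun x =>
    P.generator_comp_hamiltonian_le hHd (F := expCutoff θ R) (F' := expCutoffDeriv θ R)
      (F'' := deriv (expCutoffDeriv θ R)) (hasDerivAt_expCutoff θ R)
      (fun v => ((hasDerivAt_expCutoffDeriv θ R v).differentiableAt).hasDerivAt) hN hγ hTL hTR
      hL hR x (expCutoffDeriv_nonneg hθ _) (expCutoffDeriv_le hθ hR0 _)
      (deriv_expCutoffDeriv_le hθ hR0 _)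
  -- the orbit maps `φ(s) = P_s g (z)`, `ψ(s) = P_s (L g)(z)` (`s ≤ 0` read as `s = 0`)
  set φ : ℝ → ℝ := fun s => ∫ y, g y ∂(S.kernel s.toNNReal z) with hφdef
  set ψ : ℝ → ℝ := fun s => ∫ y, P.generator N T_L T_R g y ∂(S.kernel s.toNNReal z) with hψdef
  have hφ_meas : StronglyMeasurable φ :=
    (S.stronglyMeasurable_uncurry_act hg_cont.stronglyMeasurable).comp_measurable
      (measurable_const.prodMk measurable_id)
  have hψ_meas : StronglyMeasurable ψ :=
    (S.stronglyMeasurable_uncurry_act hLg_cont.stronglyMeasurable).comp_measurable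
      (measurable_const.prodMk measurable_id)
  have hφ_bound : ∀ s, ‖φ s‖ ≤ Real.exp (θ * (2 * R)) := fun s => S.norm_act_le _ hg_norm z
  have hψ_bound : ∀ s, ‖ψ s‖ ≤ C := fun s => S.norm_act_le _ hC z
  have hφ_nonneg : ∀ s, 0 ≤ φ s := fun s => integral_nonneg hg_nonneg
  have hφ_int : ∀ a b, IntervalIntegrable φ volume a b := intervalIntegrable_of_norm_le hφ_meas hφ_bound
  have hψ_int : ∀ a b, IntervalIntegrable ψ volume a b := intervalIntegrable_of_norm_le hψ_meas hψ_bound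
  have hψ_le : ∀ s, ψ s ≤ K * φ s := fun s => by
    calc ψ s ≤ ∫ y, K * g y ∂(S.kernel s.toNNReal z) :=
          integral_mono (S.integrable_kernel_of_norm_le _ z hLg_cont hC)
            ((S.integrable_kernel_of_norm_le _ z hg_cont hg_norm).const_mul K) hLg_le
      _ = K * φ s := integral_const_mul K g
  -- Dynkin's identity for `u`: `φ(s) = g(z) + ∫₀ˢ ψ` for `s ≥ 0`
  have hdyn : ∀ s : ℝ, 0 ≤ s → φ s = g z + ∫ r in (0 : ℝ)..s, ψ r := by
    intro s hs
    have h := S.dynkin u hu_smooth hu_supp s.toNNReal z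
    rw [Real.coe_toNNReal _ hs, hLu] at h
    have hint : ∫ y, u y ∂(S.kernel s.toNNReal z) = φ s - c := by
      simp only [hudef]
      rw [integral_sub (S.integrable_kernel_of_norm_le _ z hg_cont hg_norm) (integrable_const c)]
      simp [hφdef]
    rw [hint] at h
    have hu0 : u z = g z - c := rfl
    rw [hu0] at h
    change φ s = g z + ∫ r in (0 : ℝ)..s, ψ r
    linarith
  have hφ_eq : φ = fun s => g z + ∫ r in (0 : ℝ)..(max s 0), ψ r := by
    funext s
    rcases le_total 0 s with hs | hs
    · rw [max_eq_left hs]; exact hdyn s hs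
    · rw [max_eq_right hs, intervalIntegral.integral_same, add_zero]
      change ∫ y, g y ∂(S.kernel s.toNNReal z) = g z
      rw [Real.toNNReal_of_nonpos hs, kernel_zero_apply, integral_dirac]
  have hφ_cont : Continuous φ := by
    rw [hφ_eq]
    exact continuous_const.add
      ((intervalIntegral.continuous_primitive hψ_int 0).comp (continuous_id.max continuous_const))
  -- Gronwall for `Φ(s) = ∫₀ˢ φ`: `Φ' = φ ≤ g z + K Φ`
  set Φ : ℝ → ℝ := fun s => ∫ r in (0 : ℝ)..s, φ r with hΦdef
  have hΦ_deriv : ∀ s, HasDerivAt Φ (φ s) s := fun s =>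
    (hφ_cont.integral_hasStrictDerivAt 0 s).hasDerivAt
  have hΦ_nonneg : ∀ s, 0 ≤ s → 0 ≤ Φ s := fun s hs =>
    intervalIntegral.integral_nonneg hs fun r _ => hφ_nonneg r
  have hφ_le : ∀ s, 0 ≤ s → φ s ≤ g z + K * Φ s := by
    intro s hs
    rw [hdyn s hs]
    have h1 : ∫ r in (0 : ℝ)..s, ψ r ≤ ∫ r in (0 : ℝ)..s, K * φ r :=
      intervalIntegral.integral_mono_on hs (hψ_int 0 s) ((hφ_int 0 s).const_mul K)
        fun r _ => hψ_le r
    rw [intervalIntegral.integral_const_mul] at h1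
    linarith
  have hG : ∀ x ∈ Icc (0 : ℝ) t, ‖Φ x‖ ≤ gronwallBound 0 K (g z) (x - 0) := by
    refine norm_le_gronwallBound_of_norm_deriv_right_le (f' := φ)
      (fun x _ => (hΦ_deriv x).continuousAt.continuousWithinAt)
      (fun x _ => (hΦ_deriv x).hasDerivWithinAt) (by simp [hΦdef]) fun x hx => ?_
    rw [Real.norm_of_nonneg (hφ_nonneg x), Real.norm_of_nonneg (hΦ_nonneg x hx.1)]
    linarith [hφ_le x hx.1]
  have ht0 : (0 : ℝ) ≤ t := t.coe_nonneg
  have hGt := hG t ⟨ht0, le_rfl⟩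
  rw [sub_zero, Real.norm_of_nonneg (hΦ_nonneg t ht0)] at hGt
  -- conclusion
  have hφt : φ t = ∫ y, g y ∂(S.kernel t z) := by
    simp only [hφdef, Real.toNNReal_coe]
  rw [← hφt]
  have hK0 : 0 ≤ K := by
    have : 0 ≤ T_L + T_R := add_nonneg hTL hTR
    positivity
  rcases hK0.eq_or_lt with hK | hK
  · -- `K = 0`
    have := hφ_le t ht0
    rw [← hK] at this ⊢
    simpa using this
  · have hne : K ≠ 0 := hK.ne'
    rw [gronwallBound_of_K_ne_0 hne] at hGt
    simp only [zero_mul, zero_add] at hGt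
    have h1 := hφ_le t ht0
    have h2 : K * Φ t ≤ g z * (Real.exp (K * t) - 1) := by
      calc K * Φ t ≤ K * (g z / K * (Real.exp (K * t) - 1)) := mul_le_mul_of_nonneg_left hGt hK.le
        _ = g z * (Real.exp (K * t) - 1) := by field_simp
    calc φ t ≤ g z + K * Φ t := h1
      _ ≤ g z + g z * (Real.exp (K * t) - 1) := by linarith
      _ = Real.exp (K * t) * g z := by ring

/-- **Cuneo–Eckmann–Hairer–Rey-Bellet 2018, eq. (3.4) `P^t e^{θH} ≤ e^{C_* t} e^{θH}`, PROVED for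
every Markov semigroup of the chain** (interface `LangevinChainSemigroup`): for smooth potentials
with compact energy sublevel sets, `γ, T_L, T_R ≥ 0`, `N ≥ 1` and `0 ≤ θ` with `θT_L, θT_R ≤ 1`,
`∫ e^{θH(y)} P_t(z, dy) ≤ e^{θγ(T_L+T_R)t} e^{θH(z)}` (Lebesgue integral; `C_* = θ∑_b γ_b T_b`).
From the truncated bound by Fatou's lemma. [cite: CuneoEckmannHairerReyBellet2018, §3 eq. (3.4)] -/
theorem lintegral_exp_mul_hamiltonian_le (hU : ContDiff ℝ ∞ P.U) (hV : ContDiff ℝ ∞ P.V)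
    (hN : 0 < N) (hγ : 0 ≤ P.γ) (hTL : 0 ≤ T_L) (hTR : 0 ≤ T_R)
    (hprop : ∀ E : ℝ, IsCompact {x : PhaseSpace N | P.hamiltonian N x ≤ E})
    {θ : ℝ} (hθ : 0 ≤ θ) (hL : θ * T_L ≤ 1) (hR : θ * T_R ≤ 1) (t : ℝ≥0) (z : PhaseSpace N) :
    ∫⁻ y, ENNReal.ofReal (Real.exp (θ * P.hamiltonian N y)) ∂(S.kernel t z) ≤
      ENNReal.ofReal (Real.exp (θ * P.γ * (T_L + T_R) * t) *
        Real.exp (θ * P.hamiltonian N z)) := by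
  have hHc : Continuous (P.hamiltonian N) := P.continuous_hamiltonian hU.continuous hV.continuous N
  set f : ℕ → PhaseSpace N → ℝ≥0∞ := fun n y =>
    ENNReal.ofReal (expCutoff θ (n + 1) (P.hamiltonian N y)) with hfdef
  have hf_meas : ∀ n, Measurable (f n) := fun n =>
    ENNReal.measurable_ofReal.comp ((continuous_expCutoff _ _).comp hHc).measurable
  have hf_tendsto : ∀ y, Tendsto (fun n => f n y) atTop
      (𝓝 (ENNReal.ofReal (Real.exp (θ * P.hamiltonian N y)))) := fun y =>
    (ENNReal.continuous_ofReal.tendsto _).comp (tendsto_expCutoff_atTop θ _)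
  calc ∫⁻ y, ENNReal.ofReal (Real.exp (θ * P.hamiltonian N y)) ∂(S.kernel t z)
      = ∫⁻ y, liminf (fun n => f n y) atTop ∂(S.kernel t z) :=
        lintegral_congr fun y => ((hf_tendsto y).liminf_eq).symm
    _ ≤ liminf (fun n => ∫⁻ y, f n y ∂(S.kernel t z)) atTop := lintegral_liminf_le hf_meas
    _ ≤ ENNReal.ofReal (Real.exp (θ * P.γ * (T_L + T_R) * t) *
          Real.exp (θ * P.hamiltonian N z)) := by
        refine liminf_le_of_frequently_le' (Eventually.of_forall fun n => ?_).frequently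
        have hR0 : (0 : ℝ) < n + 1 := by positivity
        have hint : Integrable (fun y => expCutoff θ (n + 1) (P.hamiltonian N y)) (S.kernel t z) :=
          S.integrable_kernel_of_norm_le t z ((continuous_expCutoff _ _).comp hHc) fun y => by
            rw [Real.norm_of_nonneg (expCutoff_pos hθ hR0 _).le]
            exact expCutoff_le_exp_two_mul hθ hR0 _
        simp only [hfdef]
        rw [← ofReal_integral_eq_lintegral_ofReal hint
          (Eventually.of_forall fun y => (expCutoff_pos hθ hR0 _).le)]
        refine ENNReal.ofReal_le_ofReal ?_
        exact (S.integral_expCutoff_hamiltonian_le hU hV hN hγ hTL hTR hprop hθ hL hR hR0 t z).trans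
          (mul_le_mul_of_nonneg_left (expCutoff_le_exp hθ hR0 _) (Real.exp_pos _).le)

end LangevinChainSemigroup

/-- **(3.4) for the pinned chain**, in the form of the conjunct of
`CuneoEckmannHairerReyBellet2018_lyapunov`: for `pinnedChain ω₂ lam β γ` (`ω₂ > 0`,
`lam, β, γ ≥ 0`), `N ≥ 1`, `T_L, T_R > 0`, EVERY Markov semigroup `S` of the chain and every
`0 < θ < 1/max(T_L, T_R)`: `∫ e^{θH} dP_t(z, ·) ≤ e^{θγ(T_L+T_R)t} e^{θH(z)}`.
[cite: CuneoEckmannHairerReyBellet2018, §3 eq. (3.4)] -/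
theorem pinnedChain_lintegral_exp_mul_hamiltonian_kernel_le {ω₂ lam β γ : ℝ} (hω : 0 < ω₂)
    (hl : 0 ≤ lam) (hβ : 0 ≤ β) (hγ : 0 ≤ γ) {N : ℕ} (hN : 0 < N) {T_L T_R : ℝ} (hTL : 0 < T_L)
    (hTR : 0 < T_R) (S : LangevinChainSemigroup (pinnedChain ω₂ lam β γ) N T_L T_R) {θ : ℝ}
    (hθ : 0 < θ) (hθ' : θ < 1 / max T_L T_R) (t : ℝ≥0) (z : PhaseSpace N) :
    ∫⁻ y, ENNReal.ofReal (Real.exp (θ * (pinnedChain ω₂ lam β γ).hamiltonian N y)) ∂(S.kernel t z) ≤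
      ENNReal.ofReal (Real.exp (θ * γ * (T_L + T_R) * t) *
        Real.exp (θ * (pinnedChain ω₂ lam β γ).hamiltonian N z)) := by
  have hm : 0 < max T_L T_R := lt_max_of_lt_left hTL
  have hθm : θ * max T_L T_R ≤ 1 := ((lt_div_iff₀ hm).1 hθ').le
  have hL : θ * T_L ≤ 1 := (mul_le_mul_of_nonneg_left (le_max_left _ _) hθ.le).trans hθm
  have hR : θ * T_R ≤ 1 := (mul_le_mul_of_nonneg_left (le_max_right _ _) hθ.le).trans hθm
  exact S.lintegral_exp_mul_hamiltonian_le (pinnedChain_contDiff_U ω₂ lam β γ)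
    (pinnedChain_contDiff_V ω₂ lam β γ) hN hγ hTL.le hTR.le
    (pinnedChain_isCompact_setOf_hamiltonian_le hω hl hβ γ N) hθ.le hL hR t z

end Literature.MathematicalPhysics.KineticTheory.HeatConduction
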